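import Summits.Ventures.YMGap.Thresholds.StarUniquenessZd
import Summits.Ventures.YMGap.Thresholds.StarKernel
import HarnessLib

/-!
# Venture YMGap — track (c) «DS»: the CHART between the vertex-star kernels of the torus `(ℤ/L)^d`
# (`L ≥ 5`) and of the infinite lattice `ℤ^d` (part 1 of the torus → `ℤ^d` transfer)

HONEST FRAMING: venture file (cell `pub-ymgap`, PLAN R101/R102), strong-coupling LATTICE statement;
nothing about the continuum, confinement at weak coupling, or the mass gap. The cell's Lemma G
(`starWindowBound_lemmaG`, ds-4) delivers the star window bound `DSWindow.StarWindowBound L β_W ρ r` on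
every torus of side `L ≥ 3`. The star kernel is a LOCAL object: the law of the `2d` star links given the
exterior reads the exterior only on the links of the `2d(d−1)`… star plaquettes, all based within
sup-distance `2` of the vertex. On a torus of side `L ≥ 5` the reduction `ℤ^d → (ℤ/L)^d` is injective on
that neighbourhood, so the `ℤ^d` star kernel of the tree's infinite-volume Wilson specification
`ymSpecification (fundamentalRep (Fin N)) β` IS the torus star kernel read through the chart
(`integral_ymSpecification_vertexStarZd_eq_torus`, this file). The transfer of the window bound itself and
the infinite-volume rows are in `StarTransferZd.lean` (part 2). Pure bookkeeping; nothing is asserted about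
any window bound here.

## Contents
* chart lemmas: `image_torusEdge_vertexStarZd` (the projected star is the torus star),
  `image_projPlaq_plaquettesTouching` (the projected star plaquettes are the torus star plaquettes),
  `injOn_torusProj_near` / `injOn_torusEdge_starNbhdZd` / `injOn_projPlaq_star` (`L ≥ 5`);
* `chartIdx` (the chart on star indices), `torusLift_glueWith_chart`, `starLogWeight_glueWith_chart`,
  `integral_comp_chartIdx`, `integral_torusWeightSpec_vertexStar_eq_div`;
* `integral_ymSpecification_vertexStarZd_eq_torus` — the `ℤ^d` star kernel equals the torus star
  kernel through the chart, on star-local observables, for exteriors agreeing on the locality set.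

References: H.-O. Georgii (2011) (2.15), Thm. 4.17; S. Friedli, Y. Velenik (2017) (6.34); cell files
`LEAN-KROW.md` (ds-1), `B4-BLUEPRINT.md` (ds-4); tree `LatticeGaugeDLRGibbsProofs.lean` (the same chart
for the torus Wilson STATE, `wilsonExpectation_toTorusObservable_eq`).
-/

noncomputable section

open MeasureTheory ProbabilityTheory Function Finset
open Literature.Probability.LatticeModels
open Literature.Probability.LatticeModels.DobrushinMetric (IsLipBound)
open Literature.MathematicalPhysics.QuantumLattice
open Literature.MathematicalPhysics.QuantumFieldTheory (Edge GaugeConfig Plaquette plaquetteHolonomy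
  torusWeightSpec haarProbability plaqEdgesT suFrobDist suFrobDist_nonneg)
open Literature.MathematicalPhysics.QuantumFieldTheory.Balaban1983to89.StrongCouplingTorusWindow
  (wilsonPlaqWeight continuous_wilsonPlaqWeight)
open Summit.Ventures.YMGap.DSWindow (linkEnds mem_linkEnds vertexStar mem_vertexStar starWin
  IsLinkWindowContraction StarWindowBound)
open Summit.Ventures.YMGap.StarKernel (starPlaqs mem_starPlaqs starLogWeight
  integral_torusWeightSpec_vertexStar)

namespace Summit.Ventures.YMGap.DSWindowZd

variable {d L : ℕ}

/-- `SU(N)` (notation local to this file). -/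
local notation "SU" N => Matrix.specialUnitaryGroup (Fin N) ℂ

/-! ### The chart: the projected star, the projected star plaquettes, injectivity for `L ≥ 5` -/

/-- The projection of a shifted site: `proj (x + e_i) = (proj x).shift i`. -/
theorem torusProj_add_single_one' (x : Site d) (i : Fin d) :
    Torus.proj L (x + Pi.single i 1) =
      Literature.MathematicalPhysics.QuantumFieldTheory.Site.shift (Torus.proj L x) i := by
  rw [torusProj_add_single, Int.cast_one]
  rfl

/-- **The projected star is the torus star**: `torusEdge L` maps the `ℤ^d` vertex star of `s` onto the
torus vertex star of `proj s` (any side `L`). -/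
theorem image_torusEdge_vertexStarZd [NeZero L] (s : Site d) :
    (vertexStarZd s).image (torusEdge L) = vertexStar (Torus.proj L s) := by
  ext x
  rw [Finset.mem_image, mem_vertexStar, mem_linkEnds]
  constructor
  · rintro ⟨e, he, rfl⟩
    rcases mem_vertexStarZd.1 he with h | h
    · left
      rw [h]
      rfl
    · right
      show Torus.proj L s = Literature.MathematicalPhysics.QuantumFieldTheory.Site.shift
        (Torus.proj L e.1) e.2
      rw [h, torusProj_add_single_one']
  · rintro (h | h)
    · refine ⟨(s, x.2), mem_vertexStarZd.2 (Or.inl rfl), ?_⟩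
      show ((Torus.proj L s, x.2) : Edge d L) = x
      rw [h]
    · refine ⟨(s - Pi.single x.2 1, x.2), mem_vertexStarZd.2 (Or.inr ?_), ?_⟩
      · show s = s - Pi.single x.2 1 + Pi.single x.2 1
        rw [sub_add_cancel]
      · have hx : Torus.proj L (s - Pi.single x.2 1) = x.1 := by
          rw [torusProj_sub_single_one, h]
          show x.1 + Pi.single x.2 1 - Pi.single x.2 1 = x.1
          rw [add_sub_cancel_right]
        show ((Torus.proj L (s - Pi.single x.2 1), x.2) : Edge d L) = x
        rw [hx]

/-- Membership in the four edges of a torus plaquette, with the shifts unfolded. -/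
theorem mem_plaqEdgesT_iff' {q : Plaquette d L} {e : Edge d L} :
    e ∈ plaqEdgesT q ↔ e = (q.1, q.2.1.1) ∨ e = (q.1 + Pi.single q.2.1.1 1, q.2.1.2) ∨
      e = (q.1 + Pi.single q.2.1.2 1, q.2.1.1) ∨ e = (q.1, q.2.1.2) := by
  simp only [plaqEdgesT, Finset.mem_insert, Finset.mem_singleton]
  rfl

/-- `torusEdge` maps the edges of a plaquette of `ℤ^d` to the edges of the projected plaquette. -/
theorem torusEdge_mem_plaqEdgesT_proj {p : ZdPlaquette d} {e : ZdEdge d} (he : e ∈ plaquetteEdges p) :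
    torusEdge L e ∈ plaqEdgesT ((Torus.proj L p.1, p.2) : Plaquette d L) := by
  rw [mem_plaqEdgesT_iff']
  simp only [plaquetteEdges, Finset.mem_insert, Finset.mem_singleton] at he
  simp only [torusEdge]
  rcases he with rfl | rfl | rfl | rfl
  · exact Or.inl rfl
  · exact Or.inr (Or.inl (by rw [torusProj_add_single, Int.cast_one]))
  · exact Or.inr (Or.inr (Or.inl (by rw [torusProj_add_single, Int.cast_one])))
  · exact Or.inr (Or.inr (Or.inr rfl))

/-- **The projected star plaquettes are the torus star plaquettes**: the plaquettes of `ℤ^d` touching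
the vertex star of `s` project onto the torus star plaquettes of `proj s` (any side `L`). -/
theorem image_projPlaq_plaquettesTouching [NeZero L] (s : Site d) :
    (plaquettesTouching (vertexStarZd s)).image
        (fun p : ZdPlaquette d => ((Torus.proj L p.1, p.2) : Plaquette d L)) =
      starPlaqs (Torus.proj L s) := by
  ext q
  simp only [Finset.mem_image, mem_starPlaqs]
  constructor
  · rintro ⟨p, hp, rfl⟩
    obtain ⟨e, he⟩ := mem_plaquettesTouching_iff.1 hp
    rw [Finset.mem_inter] at he
    refine ⟨torusEdge L e, torusEdge_mem_plaqEdgesT_proj he.1, ?_⟩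
    rw [← image_torusEdge_vertexStarZd]
    exact Finset.mem_image_of_mem _ he.2
  · rintro ⟨x, hxq, hxs⟩
    rw [← image_torusEdge_vertexStarZd, Finset.mem_image] at hxs
    obtain ⟨e, he, rfl⟩ := hxs
    obtain ⟨p, hp, hpq⟩ := exists_proj_eq_of_torusEdge_eq he q (mem_plaqEdgesT_iff'.1 hxq)
    exact ⟨p, hp, hpq⟩

/-- **Injectivity of the reduction near a vertex**: for `L ≥ 5`, `Torus.proj L` is injective on the sites
within sup-distance `2` of `s`. -/
theorem injOn_torusProj_near (hL : 5 ≤ L) (s : Site d) :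
    Set.InjOn (Torus.proj L) {a : Site d | ∀ i, (a i - s i).natAbs ≤ 2} := by
  intro a ha b hb hab
  funext i
  have h1 : ((a i : ℤ) : ZMod L) = ((b i : ℤ) : ZMod L) := congr_fun hab i
  rw [ZMod.intCast_eq_intCast_iff_dvd_sub] at h1
  have ha' := ha i
  have hb' := hb i
  have h3 : |b i - a i| < (L : ℤ) := by
    rw [abs_lt]
    constructor <;> omega
  have := Int.eq_zero_of_abs_lt_dvd h1 h3
  omega

/-- For `L ≥ 5`, `torusEdge L` is injective on the locality set of a vertex star. -/
theorem injOn_torusEdge_starNbhdZd (hL : 5 ≤ L) (s : Site d) :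
    Set.InjOn (torusEdge (d := d) L) ↑(starNbhdZd s) := by
  classical
  refine injOn_torusEdge ((injOn_torusProj_near hL s).mono fun a ha => ?_)
  obtain ⟨y, hy, rfl⟩ := Finset.mem_image.1 (Finset.mem_coe.1 ha)
  exact natAbs_sub_le_two_of_mem_starNbhdZd hy

/-- For `L ≥ 5`, the projection of plaquettes is injective on the plaquettes touching a vertex star. -/
theorem injOn_projPlaq_star (hL : 5 ≤ L) (s : Site d) :
    Set.InjOn (fun p : ZdPlaquette d => ((Torus.proj L p.1, p.2) : Plaquette d L))
      ↑(plaquettesTouching (vertexStarZd s)) := by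
  classical
  refine injOn_projPlaquette (Finset.Subset.refl _) ((injOn_torusProj_near hL s).mono fun a ha => ?_)
  obtain ⟨y, hy, rfl⟩ := Finset.mem_image.1 (Finset.mem_coe.1 ha)
  exact natAbs_sub_le_two_of_mem_starNbhdZd (Finset.mem_union_right _ hy)

/-! ### The `ℤ^d` star kernel is the torus star kernel through the chart -/

section Kernel

variable {N : ℕ}

/-- The periodic lift `V ↦ V ∘ torusEdge L` is measurable. -/
theorem measurable_torusLift' : Measurable (torusLift (d := d) (G := SU N) L) :=
  measurable_pi_lambda _ fun e => measurable_pi_apply (torusEdge L e)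

variable [NeZero L]

/-- A star link projects into the torus star. -/
theorem torusEdge_mem_vertexStar_proj {s : Site d} {e : ZdEdge d} (he : e ∈ vertexStarZd s) :
    torusEdge L e ∈ vertexStar (Torus.proj L s) := by
  rw [← image_torusEdge_vertexStarZd]
  exact Finset.mem_image_of_mem _ he

variable (L) in
/-- **The chart on star indices**: a link of the `ℤ^d` star of `s`, read as a link of the torus star of
`proj s`. -/
def chartIdx (s : Site d) (e : ↥(vertexStarZd s)) : ↥(vertexStar (Torus.proj L s)) :=
  ⟨torusEdge L e.1, torusEdge_mem_vertexStar_proj e.2⟩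

/-- The chart on star indices is injective for `L ≥ 5`. -/
theorem chartIdx_injective (hL : 5 ≤ L) (s : Site d) : Function.Injective (chartIdx (d := d) L s) := by
  intro a b h
  have h' : torusEdge L a.1 = torusEdge L b.1 := congrArg Subtype.val h
  exact Subtype.ext (injOn_torusEdge_starNbhdZd hL s (vertexStarZd_subset_starNbhdZd s a.2)
    (vertexStarZd_subset_starNbhdZd s b.2) h')

/-- Off the star, a link of the locality set does not project into the torus star (`L ≥ 5`). -/
theorem torusEdge_not_mem_vertexStar_proj (hL : 5 ≤ L) {s : Site d} {e : ZdEdge d}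
    (he : e ∈ starNbhdZd s) (heΛ : e ∉ vertexStarZd s) :
    torusEdge L e ∉ vertexStar (Torus.proj L s) := by
  rw [← image_torusEdge_vertexStarZd]
  intro hmem
  obtain ⟨e', he', hee'⟩ := Finset.mem_image.1 hmem
  exact heΛ (injOn_torusEdge_starNbhdZd hL s (vertexStarZd_subset_starNbhdZd s he') he hee' ▸ he')

/-- **The glued configurations agree through the chart on the locality set.** If the torus exterior
`ω'` agrees with `ω` through the chart on `starNbhdZd s`, then gluing the inside datum `ζ` into `ω'` on
the torus star and lifting periodically agrees, on `starNbhdZd s`, with gluing `ζ ∘ chartIdx` into `ω` on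
the `ℤ^d` star. -/
theorem torusLift_glueWith_chart (hL : 5 ≤ L) (s : Site d) {G : Type*} (ω : LGConfig d G)
    (ω' : GaugeConfig d L G) (hω : ∀ e ∈ starNbhdZd s, ω' (torusEdge L e) = ω e)
    (ζ : ↥(vertexStar (Torus.proj L s)) → G) {e : ZdEdge d} (he : e ∈ starNbhdZd s) :
    torusLift L (glueWith (vertexStar (Torus.proj L s)) ζ ω') e =
      glueWith (vertexStarZd s) (fun k => ζ (chartIdx L s k)) ω e := by
  simp only [torusLift, Function.comp_apply]
  by_cases heΛ : e ∈ vertexStarZd s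
  · rw [glueWith_apply_mem _ _ _ heΛ,
      glueWith_apply_mem _ _ _ (torusEdge_mem_vertexStar_proj (L := L) heΛ)]
    rfl
  · rw [glueWith_apply_not_mem _ _ _ (torusEdge_not_mem_vertexStar_proj hL he heΛ),
      glueWith_apply_not_mem _ _ _ heΛ, hω e he]

/-- **The star energies agree through the chart**: the torus star energy of the Wilson plaquette weight at
`β` (`Σ_{q ∈ starPlaqs} log v(U_q)`, `log v(U) = −β(N − Re tr U)`) of the glued torus configuration equals
`−β` times the boundary Wilson action of the `ℤ^d` star of the corresponding glued `ℤ^d` configuration. -/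
theorem starLogWeight_glueWith_chart (hL : 5 ≤ L) (β : ℝ) (s : Site d) (ω : LGConfig d (SU N))
    (ω' : GaugeConfig d L (SU N)) (hω : ∀ e ∈ starNbhdZd s, ω' (torusEdge L e) = ω e)
    (ζ : ↥(vertexStar (Torus.proj L s)) → SU N) :
    starLogWeight (wilsonPlaqWeight N β) (Torus.proj L s) (glueWith (vertexStar (Torus.proj L s)) ζ ω') =
      -β * wilsonBoundaryAction (fundamentalRep (Fin N)) (vertexStarZd s)
        (glueWith (vertexStarZd s) (fun k => ζ (chartIdx L s k)) ω) := by
  have h1 : starLogWeight (wilsonPlaqWeight N β) (Torus.proj L s)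
        (glueWith (vertexStar (Torus.proj L s)) ζ ω') =
      -β * ∑ q ∈ starPlaqs (Torus.proj L s), ((N : ℝ) -
        ((fundamentalRep (Fin N)) (plaquetteHolonomy (glueWith (vertexStar (Torus.proj L s)) ζ ω')
          q.1 q.2.1.1 q.2.1.2)).trace.re) := by
    simp only [starLogWeight, wilsonPlaqWeight, Real.log_exp, fundamentalRep_apply, Finset.mul_sum]
    refine Finset.sum_congr rfl fun q _ => ?_
    ring
  have h2 : wilsonBoundaryAction (fundamentalRep (Fin N)) (vertexStarZd s)
        (torusLift L (glueWith (vertexStar (Torus.proj L s)) ζ ω')) =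
      wilsonBoundaryAction (fundamentalRep (Fin N)) (vertexStarZd s)
        (glueWith (vertexStarZd s) (fun k => ζ (chartIdx L s k)) ω) :=
    isCylinder_wilsonBoundaryAction_holds (fundamentalRep (Fin N)) (vertexStarZd s) fun e he =>
      torusLift_glueWith_chart hL s ω ω' hω ζ (Finset.mem_union_right _ (Finset.mem_coe.1 he))
  rw [h1, ← image_projPlaq_plaquettesTouching s,
    sum_image_proj_plaquetteTerm (fundamentalRep (Fin N)) (injOn_projPlaq_star hL s)
      (glueWith (vertexStar (Torus.proj L s)) ζ ω'), h2]

/-- **Reindexing the product Haar measure along the chart**: integrating `H(ζ ∘ chartIdx)` over the torus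
star factors equals integrating `H` over the `ℤ^d` star factors (`pi_map_comp_injective`). -/
theorem integral_comp_chartIdx (hL : 5 ≤ L) (s : Site d) {H : (↥(vertexStarZd s) → SU N) → ℝ}
    (hH : Measurable H) :
    ∫ ζ, H (fun k => ζ (chartIdx L s k)) ∂(Measure.pi fun _ : ↥(vertexStar (Torus.proj L s)) =>
        haarProbability (SU N)) =
      ∫ ζ, H ζ ∂(Measure.pi fun _ : ↥(vertexStarZd s) => haarProbability (SU N)) := by
  rw [← pi_map_comp_injective (haarProbability (SU N)) (chartIdx_injective hL s),
    integral_map (measurable_pi_iff.2 fun k => measurable_pi_apply (chartIdx L s k)).aemeasurable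
      hH.aestronglyMeasurable]

/-- **The torus star kernel as a ratio of product-Haar integrals** (from
`StarKernel.integral_torusWeightSpec_vertexStar`): `γ_{Λ⋆}(f | ω̄) = (∫ f(ζ ω̄) e^{E(ζ ω̄)} dζ) / (∫ e^{E(ζ ω̄)} dζ)`
with the STAR energy `E = Σ_{q ∈ starPlaqs} log v(U_q)`. -/
theorem integral_torusWeightSpec_vertexStar_eq_div (β : ℝ)
    (t : Literature.MathematicalPhysics.QuantumFieldTheory.Site d L)
    (ω : GaugeConfig d L (SU N)) {f : GaugeConfig d L (SU N) → ℝ} (hfm : Measurable f) :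
    ∫ U, f U ∂(torusWeightSpec (wilsonPlaqWeight N β) (vertexStar t) ω) =
      (∫ ζ, f (glueWith (vertexStar t) ζ ω) *
          Real.exp (starLogWeight (wilsonPlaqWeight N β) t (glueWith (vertexStar t) ζ ω))
          ∂(Measure.pi fun _ : ↥(vertexStar t) => haarProbability (SU N))) /
        ∫ ζ, Real.exp (starLogWeight (wilsonPlaqWeight N β) t (glueWith (vertexStar t) ζ ω))
          ∂(Measure.pi fun _ : ↥(vertexStar t) => haarProbability (SU N)) := by
  haveI : SecondCountableTopology (Matrix (Fin N) (Fin N) ℂ) :=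
    inferInstanceAs (SecondCountableTopology (Fin N → Fin N → ℂ))
  haveI : SecondCountableTopology (SU N) := Topology.IsEmbedding.subtypeVal.secondCountableTopology
  rw [integral_torusWeightSpec_vertexStar (continuous_wilsonPlaqWeight β) t ω hfm, integral_tilted]
  simp only [smul_eq_mul]
  rw [← integral_div]
  refine integral_congr_ae (ae_of_all _ fun ζ => ?_)
  ring

/-- **THE CHART IDENTITY.** Let `L ≥ 5`, `s ∈ ℤ^d`, `ω` an exterior field on `ℤ^d` and `ω'` a torus field
agreeing with `ω` through the chart on the locality set of the star (`ω' (torusEdge e) = ω e` for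
`e ∈ starNbhdZd s`). Then for every measurable star-local `F`, the `ℤ^d` star kernel of the Wilson
specification at bare coupling `β` and the torus star kernel of the Wilson plaquette weight at `β` give
`F` the same mean: `γ^{ℤ^d}_{Λ⋆(s)}(F | ω) = γ^{(ℤ/L)^d}_{Λ⋆(proj s)}(F ∘ torusLift | ω')`. Both are ratios of
product-Haar integrals over the `2d` star links with the star energy; the energies agree because the
star plaquettes correspond under the chart (`image_projPlaq_plaquettesTouching`, `injOn_projPlaq_star`)
and their links lie in the locality set. -/
theorem integral_ymSpecification_vertexStarZd_eq_torus (hL : 5 ≤ L) (β : ℝ) (s : Site d)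
    (ω : LGConfig d (SU N)) (ω' : GaugeConfig d L (SU N))
    (hω : ∀ e ∈ starNbhdZd s, ω' (torusEdge L e) = ω e)
    {F : LGConfig d (SU N) → ℝ} (hFm : Measurable F)
    (hFdep : DependsOn F (vertexStarZd s : Set (ZdEdge d))) :
    ∫ U, F U ∂(ymSpecification (d := d) (fundamentalRep (Fin N)) β (vertexStarZd s) ω) =
      ∫ V, F (torusLift L V)
        ∂(torusWeightSpec (wilsonPlaqWeight N β) (vertexStar (Torus.proj L s)) ω') := by
  -- `SU(N) ⊆ M_N(ℂ)` is second countable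
  haveI : SecondCountableTopology (Matrix (Fin N) (Fin N) ℂ) :=
    inferInstanceAs (SecondCountableTopology (Fin N → Fin N → ℂ))
  haveI : SecondCountableTopology (SU N) := Topology.IsEmbedding.subtypeVal.secondCountableTopology
  -- the observable agrees through the chart
  have hF : ∀ ζ : ↥(vertexStar (Torus.proj L s)) → SU N,
      F (torusLift L (glueWith (vertexStar (Torus.proj L s)) ζ ω')) =
        F (glueWith (vertexStarZd s) (fun k => ζ (chartIdx L s k)) ω) :=
    fun ζ => hFdep fun e he =>
      torusLift_glueWith_chart hL s ω ω' hω ζ (vertexStarZd_subset_starNbhdZd s (Finset.mem_coe.1 he))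
  -- measurability of the `ℤ^d` integrands
  have hw : Continuous fun U : LGConfig d (SU N) =>
      Real.exp (-β * wilsonBoundaryAction (fundamentalRep (Fin N)) (vertexStarZd s) U) :=
    Real.continuous_exp.comp (continuous_const.mul
      (continuous_wilsonBoundaryAction (fundamentalRep (Fin N)) (continuous_fundamentalRep (Fin N)) _))
  have hgm : Measurable fun ζ : ↥(vertexStarZd s) → SU N => glueWith (vertexStarZd s) ζ ω :=
    measurable_glueWith _ ω
  have hH₀ : Measurable fun ζ : ↥(vertexStarZd s) → SU N =>
      Real.exp (-β * wilsonBoundaryAction (fundamentalRep (Fin N)) (vertexStarZd s)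
        (glueWith (vertexStarZd s) ζ ω)) :=
    hw.measurable.comp hgm
  have hH₁ : Measurable fun ζ : ↥(vertexStarZd s) → SU N => F (glueWith (vertexStarZd s) ζ ω) *
      Real.exp (-β * wilsonBoundaryAction (fundamentalRep (Fin N)) (vertexStarZd s)
        (glueWith (vertexStarZd s) ζ ω)) :=
    (hFm.comp hgm).mul hH₀
  -- numerator and denominator agree through the chart
  have hnum : ∫ ζ, F (torusLift L (glueWith (vertexStar (Torus.proj L s)) ζ ω')) *
      Real.exp (starLogWeight (wilsonPlaqWeight N β) (Torus.proj L s)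
        (glueWith (vertexStar (Torus.proj L s)) ζ ω'))
        ∂(Measure.pi fun _ : ↥(vertexStar (Torus.proj L s)) => haarProbability (SU N)) =
      ∫ ζ, F (glueWith (vertexStarZd s) ζ ω) *
        Real.exp (-β * wilsonBoundaryAction (fundamentalRep (Fin N)) (vertexStarZd s)
          (glueWith (vertexStarZd s) ζ ω))
        ∂(Measure.pi fun _ : ↥(vertexStarZd s) => haarProbability (SU N)) := by
    rw [← integral_comp_chartIdx hL s hH₁]
    refine integral_congr_ae (ae_of_all _ fun ζ => ?_)
    dsimp only
    rw [hF ζ, starLogWeight_glueWith_chart hL β s ω ω' hω ζ]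
  have hden : ∫ ζ, Real.exp (starLogWeight (wilsonPlaqWeight N β) (Torus.proj L s)
        (glueWith (vertexStar (Torus.proj L s)) ζ ω'))
        ∂(Measure.pi fun _ : ↥(vertexStar (Torus.proj L s)) => haarProbability (SU N)) =
      ∫ ζ, Real.exp (-β * wilsonBoundaryAction (fundamentalRep (Fin N)) (vertexStarZd s)
          (glueWith (vertexStarZd s) ζ ω))
        ∂(Measure.pi fun _ : ↥(vertexStarZd s) => haarProbability (SU N)) := by
    rw [← integral_comp_chartIdx hL s hH₀]
    refine integral_congr_ae (ae_of_all _ fun ζ => ?_)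
    dsimp only
    rw [starLogWeight_glueWith_chart hL β s ω ω' hω ζ]
  -- both sides as ratios
  rw [integral_torusWeightSpec_vertexStar_eq_div β (Torus.proj L s) ω'
      (f := fun V => F (torusLift L V)) (hFm.comp measurable_torusLift'),
    integral_ymSpecification (fundamentalRep (Fin N)) (continuous_fundamentalRep (Fin N)) β
      (vertexStarZd s) hFm ω]
  show (∫ ζ, F (glueWith (vertexStarZd s) ζ ω) *
        Real.exp (-β * wilsonBoundaryAction (fundamentalRep (Fin N)) (vertexStarZd s)
          (glueWith (vertexStarZd s) ζ ω))
        ∂(Measure.pi fun _ : ↥(vertexStarZd s) => haarProbability (SU N))) /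
      (∫ ζ, Real.exp (-β * wilsonBoundaryAction (fundamentalRep (Fin N)) (vertexStarZd s)
          (glueWith (vertexStarZd s) ζ ω))
        ∂(Measure.pi fun _ : ↥(vertexStarZd s) => haarProbability (SU N))) =
    (∫ ζ, F (torusLift L (glueWith (vertexStar (Torus.proj L s)) ζ ω')) *
        Real.exp (starLogWeight (wilsonPlaqWeight N β) (Torus.proj L s)
          (glueWith (vertexStar (Torus.proj L s)) ζ ω'))
        ∂(Measure.pi fun _ : ↥(vertexStar (Torus.proj L s)) => haarProbability (SU N))) /
      ∫ ζ, Real.exp (starLogWeight (wilsonPlaqWeight N β) (Torus.proj L s)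
          (glueWith (vertexStar (Torus.proj L s)) ζ ω'))
        ∂(Measure.pi fun _ : ↥(vertexStar (Torus.proj L s)) => haarProbability (SU N))
  rw [hnum, hden]

end Kernel

end Summit.Ventures.YMGap.DSWindowZd

end
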